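import Summits.QuantumFields.BalabanUV.Beta.FP.SliceBiStencil
import Summits.QuantumFields.BalabanUV.Beta.FP.SliceVertexReflection

/-!
# `BalabanUV.Beta.FP.SliceBiStencilReflection` — road «FP» for binder row D1, row H2V-2 part 5 ∕ sub-row H2-ASM-5a (Kcov) (owner «GO sliceW4», CLAIMS 2026-08-21 l.28064 (1)):
# THE SINGLE-AXIS REFLECTION LAW **WITH CONTACT** OF THE SLICE'S SECOND-ORDER TABLE `sliceW` AGAINST THE CELL's LEG MAP — the W-clause of the (Kcov) gluon socket
# (`KernelReflectionBoundedContact2.axisReflectionCovariant_flip_hessKer_bdd_contact₂`'s `CtW`) for the slice summand of `PiBF`'s W-slot, the contact `sliceCtW` in CLOSED FORM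

HONEST DEPENDENCY (page 1, mandatory): continuum YM on T⁴ ⇐ BetaPertH ∧ nine spine estimates (0/9 proved); BetaPertH ⇐ (D1) ∧ (D4) ∧ CAP+tail;
G-an2-4 gates asym, D1 and NE2/3/4.  HONEST FRAMING (cell contract, verbatim): «discharging `BetaPertH` makes Bałaban's UV stability UNCONDITIONAL —
a real constructive-QFT result; it is NOT the continuum limit and NOT the Clay problem.»  THIS MODULE DISCHARGES NOTHING of the wall: finite algebra over
`SliceBiStencil.sliceW` (closed form ✓), `SliceVertexReflection.sEntry_bref'` ✓ and an2's reflection data `ResolventReflection.sref ∕ bref ∕ Φ`; one data definition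
(`sliceCtW`, the contact table, asserting nothing), `[our object]`∕`[folklore]`, nothing cited, no `def … : Prop`, no `sorry`; 0∕4 row-D1 binders; NOT the (Kcov) letter of
the literal (the perfect quartic jet's law is H2V-4′'s), NOT the consistency identity `tadpole(CtW) = Σ cross words(CtV)` of R5′ (the consumer's), NOT hgerm, NOT D1,
NOT BetaPertH, NOT continuum, NOT Clay.

ABSOLUTE RULE (cell charter, verbatim): «No internally-minted statement may enter as a cited fact. Every hypothesis is either kernel-proved in this package or a
verbatim quotation of a PUBLISHED theorem with page reference. The manuscript(s) under audit are NOT citable for their own disputed steps — they are the thing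
under adjudication; programme-internal (2001/route/tribunal) claims are never citable.»

THE LAW.  For every axis `α`, bonds `b = (κ,u)`, `b′ = (κ′,u′)` of `ℤ^{d+1}` and every blocking parameter `N` (the field legs of `Φ N α` do not depend on `N`):
  **`sliceW d κ (bref α κ u) κ′ (bref α κ′ u′) = (ε_κ ε_{κ′}) • refK (Φ N α) (sliceW d κ u κ′ u′ + sliceCtW d α κ u κ′ u′)`**  (`sliceW_bref`),
with the CONTACT TABLE `sliceCtW` (field–field block; zero on multiplier blocks) the sum of
* the PAIR WORD's contact `([fe(b) = fe(b′)] − [fe(b) + [κ′=α]·e_α = fe(b′) + [κ=α]·e_α])·pair(X,W)`, `fe(κ,u) := u + e_κ` the far endpoint, `pair(X,W) := [X=b][W=b′] + [W=b][X=b′]`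
  the two pinned legs: under the reflection an `α`-bond keeps its partner only through its NEAR endpoint (`bref_add_unitVec`: `bref α κ u + e_κ = sref α (fe(κ,u)) + [κ=α]·e_α`), so the
  «both bonds end at the same site» condition of `sliceW`'s `T₁T₁` word is re-read with a relative shift `e_α` when EXACTLY ONE of `κ, κ′` is `α` (`cond_bref`);
* the SAME-BOND contact `[κ=α]·[b=b′]·(−(sEntry d κ u w x b a + sEntry d κ u x w a b) + δ_{(κ,u)}(b,w)·(dδ δ_{(a,x)})_b(w) + δ_{(κ,u)}(a,x)·(dδ δ_{(b,w)})_a(x))` — the two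
  first-order laws `sEntry_bref'` contribute their `dδ` pins, and the `α`-bond's diagonal word meets ONE MORE orientation sign `ε_κ = −1` than the pair prefactor `ε_κ ε_{κ′} = 1`
  supplies, hence the `−(s + sᵀ) = −2·`(diagonal word).
The closed form was first derived by exact enumeration (`HOME/b2b-balaban-beta-d1-formalise-leaf-02/g10/check_refl2.py`, 13 bond pairs with non-zero contact at `α = 0`,
`u = 0`, `|u′|₁ ≤ 2`) and is here kernel-checked for every `d`, `α`, `b`, `b′`.
Provenance: D1 formalisation swarm seat b2b-balaban-beta-d1-formalise-leaf-02 gen 10 (road FP engine lineage), 2026-08-21.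
-/

noncomputable section

namespace Summit.QuantumFields.BalabanUV.Beta.FP.SliceBiStencilReflection

open Finset
open scoped BigOperators
open Literature.MathematicalPhysics.QuantumFieldTheory.Balaban1983to89
open Literature.MathematicalPhysics.QuantumFieldTheory.Balaban1983to89.Beta
open AffineAveraging (Form0 Form1 unitVec unitVec_apply dz codiff₁)
open KKTFluctuationKernel (delta1 delta1_apply)
open ResolventReflection (sref sref_apply sref_add sref_sub sref_sref bref bref_apply bref_bref bref_of_ne bref_self bref_add axisReflect_unitVec_of_ne
  axisReflect_unitVec_self axisReflect_zsmul reflSign_mul_self reflSign_of_ne reflSign_self Φ Φ_r_inl Φ_s_inl)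
open PolarizationSign (axisReflect axisReflect_apply axisReflect_axisReflect reflSign)
open KernelReflection (refK refK_apply)
open ExpKernelCalculus (MKer)
open OneStepResolventKernel (Fib)
open Summit.QuantumFields.BalabanUV.Beta.WilsonReflectionContact (unitVec_eq)
open Summit.QuantumFields.BalabanUV.Beta.FP.SliceVertex (sEntry sEntry_apply)
open Summit.QuantumFields.BalabanUV.Beta.FP.SliceVertexReflection (sEntry_bref' delta1_bref dz_codiff₁_delta1_bref)
open Summit.QuantumFields.BalabanUV.Beta.FP.SliceBiStencil (sliceW sliceW_inl_inl sliceW_inl_inl_apply)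

variable {d : ℕ}

/-! ## §1 How the reflection moves the far endpoint, the pins and the diagonal -/

/-- [folklore] **THE FAR ENDPOINT OF THE REFLECTED BOND**: `bref α κ u + e_κ = sref α (u + e_κ) + [κ = α]·e_α` — for `κ ≠ α` the image of the far endpoint, for `κ = α` the
image of the NEAR endpoint (orientation reversal). -/
theorem bref_add_unitVec (α κ : Fin (d + 1)) (u : Fin (d + 1) → ℤ) :
    bref α κ u + unitVec κ = sref α (u + unitVec κ) + (if κ = α then unitVec α else 0) := by
  by_cases hκ : κ = α
  · subst hκ
    rw [if_pos rfl, bref_self, sref_add, axisReflect_unitVec_self]; abel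
  · rw [if_neg hκ, bref_of_ne hκ, sref_add, axisReflect_unitVec_of_ne hκ, add_zero]

/-- [folklore] `sref a − sref b = axisReflect (a − b)`. -/
theorem sref_sub_sref (α : Fin (d + 1)) (a b : Fin (d + 1) → ℤ) : sref α a - sref α b = axisReflect α (a - b) := by
  have h := sref_add α b (a - b)
  rw [add_sub_cancel] at h
  rw [h]; abel

/-- [folklore] the reflection negates the `α`-shift: `axisReflect α ([c]·e_α) = −[c]·e_α`. -/
theorem axisReflect_ite_unitVec (α : Fin (d + 1)) (c : Prop) [Decidable c] :
    axisReflect α (if c then unitVec α else (0 : Fin (d + 1) → ℤ)) = -(if c then unitVec α else 0) := by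
  split_ifs
  · exact axisReflect_unitVec_self α
  · funext i; simp [axisReflect_apply]

/-- [folklore] **THE PAIRING CONDITION UNDER THE REFLECTION**: the two reflected bonds END at the same site iff `fe(b) + [κ′=α]·e_α = fe(b′) + [κ=α]·e_α`
(`fe(κ,u) := u + e_κ`) — the original condition `fe(b) = fe(b′)` when both or neither direction is `α`, shifted by `e_α` when exactly one is (the reflected `α`-bond pairs
through its NEAR endpoint). -/
theorem cond_bref (α κ κ' : Fin (d + 1)) (u u' : Fin (d + 1) → ℤ) :
    (bref α κ u + unitVec κ = bref α κ' u' + unitVec κ') ↔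
      (u + unitVec κ + (if κ' = α then unitVec α else 0) = u' + unitVec κ' + (if κ = α then unitVec α else 0)) := by
  rw [bref_add_unitVec, bref_add_unitVec]
  constructor
  · intro h
    have h2 : sref α (u + unitVec κ + (if κ' = α then unitVec α else 0)) = sref α (u' + unitVec κ' + (if κ = α then unitVec α else 0)) := by
      rw [sref_add α (u + unitVec κ), sref_add α (u' + unitVec κ'), axisReflect_ite_unitVec, axisReflect_ite_unitVec]
      linear_combination h
    have h3 := congrArg (sref α) h2
    rwa [sref_sref, sref_sref] at h3
  · intro h
    have h2 := congrArg (sref α) h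
    rw [sref_add α (u + unitVec κ), sref_add α (u' + unitVec κ'), axisReflect_ite_unitVec, axisReflect_ite_unitVec] at h2
    linear_combination h2

/-- [folklore] **PINS MOVE WITH THE LEG MAP**: `[x = bref α κ u ∧ a = κ] = [bref α a x = u ∧ a = κ]` (`bref α κ` is an involution). -/
theorem pin_bref (α κ a : Fin (d + 1)) (u x : Fin (d + 1) → ℤ) : (x = bref α κ u ∧ a = κ) ↔ (bref α a x = u ∧ a = κ) := by
  constructor
  · rintro ⟨rfl, rfl⟩; exact ⟨bref_bref α a u, rfl⟩
  · rintro ⟨h, rfl⟩; exact ⟨by rw [← h, bref_bref], rfl⟩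

/-- [folklore] the diagonal is preserved: `[bref α κ u = bref α κ′ u′ ∧ κ = κ′] = [u = u′ ∧ κ = κ′]`. -/
theorem diag_bref (α κ κ' : Fin (d + 1)) (u u' : Fin (d + 1) → ℤ) : (bref α κ u = bref α κ' u' ∧ κ = κ') ↔ (u = u' ∧ κ = κ') := by
  constructor
  · rintro ⟨h, rfl⟩; exact ⟨by rw [← bref_bref α κ u, h, bref_bref], rfl⟩
  · rintro ⟨rfl, rfl⟩; exact ⟨rfl, rfl⟩

/-! ## §2 The contact table -/

/-- [our object] **THE SLICE'S SECOND-ORDER CONTACT TABLE** `sliceCtW d α κ u κ′ u′` (field–field block; zero on multiplier blocks): the pair word's contact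
`([fe(b)=fe(b′)] − [fe(b) + [κ′=α]·e_α = fe(b′) + [κ=α]·e_α])·pair` plus the same-bond contact `[κ=α]·[b=b′]·(−(s + sᵀ) + the two dδ pins)` — see the header.
A definition asserting nothing. -/
def sliceCtW (d : ℕ) (α κ : Fin (d + 1)) (u : Fin (d + 1) → ℤ) (κ' : Fin (d + 1)) (u' : Fin (d + 1) → ℤ) : MKer (d + 1) (Fib d) :=
  fun x w a b =>
    match a, b with
    | Sum.inl a, Sum.inl b =>
        ((if u + unitVec κ = u' + unitVec κ' then (1 : ℝ) else 0)
            - (if u + unitVec κ + (if κ' = α then unitVec α else 0) = u' + unitVec κ' + (if κ = α then unitVec α else 0) then (1 : ℝ) else 0)) *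
          ((if x = u ∧ a = κ then (1 : ℝ) else 0) * (if w = u' ∧ b = κ' then 1 else 0)
            + (if w = u ∧ b = κ then (1 : ℝ) else 0) * (if x = u' ∧ a = κ' then 1 else 0))
        + (if κ = α then (1 : ℝ) else 0) * (if u = u' ∧ κ = κ' then (1 : ℝ) else 0) *
          (-(sEntry d κ u w x b a + sEntry d κ u x w a b)
            + delta1 κ u b w * dz (codiff₁ (delta1 a x)) b w + delta1 κ u a x * dz (codiff₁ (delta1 b w)) a x)
    | Sum.inl _, Sum.inr _ => 0
    | Sum.inr _, Sum.inl _ => 0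
    | Sum.inr _, Sum.inr _ => 0

/-- [folklore] the field–field block of the contact table (definitional). -/
theorem sliceCtW_inl_inl (α κ : Fin (d + 1)) (u : Fin (d + 1) → ℤ) (κ' : Fin (d + 1)) (u' x w : Fin (d + 1) → ℤ) (a b : Fin (d + 1)) :
    sliceCtW d α κ u κ' u' x w (Sum.inl a) (Sum.inl b) =
      ((if u + unitVec κ = u' + unitVec κ' then (1 : ℝ) else 0)
          - (if u + unitVec κ + (if κ' = α then unitVec α else 0) = u' + unitVec κ' + (if κ = α then unitVec α else 0) then (1 : ℝ) else 0)) *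
        ((if x = u ∧ a = κ then (1 : ℝ) else 0) * (if w = u' ∧ b = κ' then 1 else 0)
          + (if w = u ∧ b = κ then (1 : ℝ) else 0) * (if x = u' ∧ a = κ' then 1 else 0))
      + (if κ = α then (1 : ℝ) else 0) * (if u = u' ∧ κ = κ' then (1 : ℝ) else 0) *
        (-(sEntry d κ u w x b a + sEntry d κ u x w a b)
          + delta1 κ u b w * dz (codiff₁ (delta1 a x)) b w + delta1 κ u a x * dz (codiff₁ (delta1 b w)) a x) := rfl

/-! ## §3 The law -/

/-- [folklore] two pinned legs absorb their signs: under `[X = u ∧ a = κ]·[W = u′ ∧ b = κ′]`, `ε_a ε_b = ε_κ ε_{κ′}`. -/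
theorem pin_signs (α κ κ' a b : Fin (d + 1)) (u u' X W : Fin (d + 1) → ℤ) :
    (if X = u ∧ a = κ then (1 : ℝ) else 0) * (if W = u' ∧ b = κ' then (1 : ℝ) else 0) * (reflSign α a * reflSign α b) =
      (if X = u ∧ a = κ then (1 : ℝ) else 0) * (if W = u' ∧ b = κ' then (1 : ℝ) else 0) * (reflSign α κ * reflSign α κ') := by
  by_cases hA : X = u ∧ a = κ
  · by_cases hB : W = u' ∧ b = κ'
    · obtain ⟨-, rfl⟩ := hA; obtain ⟨-, rfl⟩ := hB; rfl
    · rw [if_neg hB]; ring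
  · rw [if_neg hA]; ring

/-- [folklore] `ε_κ = 1 − 2·[κ = α]`. -/
theorem reflSign_eq_one_sub (α κ : Fin (d + 1)) : reflSign α κ = 1 - 2 * (if κ = α then (1 : ℝ) else 0) := by
  by_cases h : κ = α
  · rw [if_pos h, h, reflSign_self]; norm_num
  · rw [if_neg h, reflSign_of_ne h]; norm_num

/-- [folklore] **THE FIELD–FIELD ENTRY OF THE LAW.** -/
theorem sliceW_bref_inl_inl (α κ : Fin (d + 1)) (u : Fin (d + 1) → ℤ) (κ' : Fin (d + 1)) (u' x w : Fin (d + 1) → ℤ) (a b : Fin (d + 1)) :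
    sliceW d κ (bref α κ u) κ' (bref α κ' u') x w (Sum.inl a) (Sum.inl b) =
      reflSign α κ * reflSign α κ' * (reflSign α a * reflSign α b *
        (sliceW d κ u κ' u' (bref α a x) (bref α b w) (Sum.inl a) (Sum.inl b)
          + sliceCtW d α κ u κ' u' (bref α a x) (bref α b w) (Sum.inl a) (Sum.inl b))) := by
  rw [sliceW_inl_inl_apply, sliceW_inl_inl_apply, sliceCtW_inl_inl]
  simp only [← unitVec_eq, cond_bref, diag_bref]
  simp only [pin_bref]
  have f1 := pin_signs α κ κ' a b u u' (bref α a x) (bref α b w)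
  have f2 := pin_signs α κ κ' b a u u' (bref α b w) (bref α a x)
  have hκ2 := reflSign_mul_self α κ
  have hκ'2 := reflSign_mul_self α κ'
  by_cases hd : u = u' ∧ κ = κ'
  · obtain ⟨rfl, rfl⟩ := hd
    rw [sEntry_bref' α κ u w x b a, sEntry_bref' α κ u x w a b]
    simp only [and_self, if_true]
    have hi := reflSign_eq_one_sub α κ
    set e : ℝ := reflSign α κ with he
    set i : ℝ := (if κ = α then (1 : ℝ) else 0) with hiκ
    have hii : i * i = i := by rw [hiκ]; split_ifs <;> norm_num
    set t1 : ℝ := (if bref α a x = u ∧ a = κ then (1 : ℝ) else 0) * (if bref α b w = u ∧ b = κ then (1 : ℝ) else 0) with ht1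
    set t2 : ℝ := (if bref α b w = u ∧ b = κ then (1 : ℝ) else 0) * (if bref α a x = u ∧ a = κ then (1 : ℝ) else 0) with ht2
    set s1 : ℝ := sEntry d κ u (bref α b w) (bref α a x) b a with hs1
    set s2 : ℝ := sEntry d κ u (bref α a x) (bref α b w) a b with hs2
    set q1 : ℝ := delta1 κ u b (bref α b w) * dz (codiff₁ (delta1 a (bref α a x))) b (bref α b w) with hq1
    set q2 : ℝ := delta1 κ u a (bref α a x) * dz (codiff₁ (delta1 b (bref α b w))) a (bref α a x) with hq2
    set g : ℝ := reflSign α a * reflSign α b with hg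
    have hg' : reflSign α b * reflSign α a = g := by rw [hg, mul_comm]
    rw [hg'] at f2 ⊢
    linear_combination f1 + f2
      + (-(g * (-(t1 + t2) + 2⁻¹ * (s1 + s2) - i * (s1 + s2) + i * (q1 + q2))) + (t1 + t2)) * hκ2
      + (g * (2⁻¹ * (s1 + s2) - i * (q1 + q2))) * hi + (2 * g * (q1 + q2)) * hii
  · rw [if_neg hd]
    set cR : ℝ := (if u + unitVec κ + (if κ' = α then unitVec α else 0) = u' + unitVec κ' + (if κ = α then unitVec α else 0) then (1 : ℝ) else 0)
      with hcR
    set t1 : ℝ := (if bref α a x = u ∧ a = κ then (1 : ℝ) else 0) * (if bref α b w = u' ∧ b = κ' then (1 : ℝ) else 0) with ht1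
    set t2 : ℝ := (if bref α b w = u ∧ b = κ then (1 : ℝ) else 0) * (if bref α a x = u' ∧ a = κ' then (1 : ℝ) else 0) with ht2
    linear_combination (cR * reflSign α κ * reflSign α κ') * f1 + (cR * reflSign α κ * reflSign α κ') * f2
      + (cR * (t1 + t2) * reflSign α κ' * reflSign α κ') * hκ2 + (cR * (t1 + t2)) * hκ'2

/-- [our object] **HEADLINE — THE REFLECTION LAW WITH CONTACT OF THE SLICE'S SECOND-ORDER TABLE** (the W-clause of the (Kcov) gluon socket for the slice summand, an2's (Wr)-with-contact
shape): `sliceW d κ (bref α κ u) κ′ (bref α κ′ u′) = (reflSign α κ * reflSign α κ′) • refK (Φ N α) (sliceW d κ u κ′ u′ + sliceCtW d α κ u κ′ u′)` for every blocking parameter `N`. -/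
theorem sliceW_bref (N : ℕ) (α κ : Fin (d + 1)) (u : Fin (d + 1) → ℤ) (κ' : Fin (d + 1)) (u' : Fin (d + 1) → ℤ) :
    sliceW d κ (bref α κ u) κ' (bref α κ' u') = (reflSign α κ * reflSign α κ') • refK (Φ N α) (sliceW d κ u κ' u' + sliceCtW d α κ u κ' u') := by
  funext x w a b
  simp only [Pi.smul_apply, Pi.add_apply, smul_eq_mul, refK_apply]
  rcases a with a | a <;> rcases b with b | b
  · rw [Φ_s_inl, Φ_s_inl, Φ_r_inl, Φ_r_inl, sliceW_bref_inl_inl]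
  · simp [sliceW, sliceCtW]
  · simp [sliceW, sliceCtW]
  · simp [sliceW, sliceCtW]

end Summit.QuantumFields.BalabanUV.Beta.FP.SliceBiStencilReflection

end
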